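import Mathlib
import HarnessLib
import Summits.HubbardSuperconductivity.HubbardSuperconductivity.Theorems.KLProgrammeKLRegimeEnginePairTransferK5Private
import Summits.HubbardSuperconductivity.HubbardSuperconductivity.Theorems.KLProgrammeKLRegimeEngineV8PairTransferExport7

/-!
# Route `KLProgramme` — ENGINE child gen 8 (stmt-HubbardSuperconductivity-20437 `KLRegimeEngineV17F2`), skeleton v2 stub (X).3 / class #5 at Export7 (rev 13 «…-REL7», ruling (R103)):
# the producer-side doors RE-KEYED to the two-package step `PairTransferStep7 P R Q₀ G Gth r u`
# (cell gate-hubbard-kl, seat hubbard-kl-k3c1-p1 g11, technique «composed-map remainder propagation»; Export7 = p1 g14's p597496, cure «REL-DIRECT» of located item «(X).3-CAP-RIGID»)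

WHY.  (R103): Export6's cap `klCTcap = 2⁻¹⁹` is producer-infeasible ((Q5) = NO: natural certified `r₀ ∈ [2², 2¹⁷]`); the cure routes the consumer around `transferBarAt`
(`…EnginePairTransferRelDoor`) and keys the relative families at a THERMAL package `Gth` (`klEngGeoTh`, `CF = 2⁴⁰`) distinct from the engine package `G` of the public history:
`PairTransferStep7 P R Q₀ G Gth r u` = `PairTransferStep6`'s binder list byte-verbatim with the K5 families (`j < n` and `n`) at `Gth`, cap `klCTcap7 = 2²⁰`, (X).3 =
`∃ e, IsTransferPkg7 e ∧ PairTransferStep7 P R (klEngQ7 P R) klEngGeo11 klEngGeoTh e.1 e.2`.  This file is the Export7 twin of `…EnginePairTransferK6Step` (p596898):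
* **`pairTransferStep7_of_base_and_succ`** — `PairTransferStep7 P R Q₀ G Gth r u` from a BASE clause (the K5 family at `n = 0`, keyed `Gth`) and a STEP clause (`K5 n → K5 (n+1)` at `Gth`),
  both under Step7's binders at their scale (history at `G`);
* **`pairTransferStep7_of_private`** — `PairTransferStep7 P R Q₀ G Gth r u` from `R.WF2`, the bare frame's admissibility `h0`, a private predicate `Priv Q cc μ U β L M n` with
  BASE / STEP / EXPORT clauses (EXPORT concludes the K5 family at `Gth`; the handed `∀ j < n` history is not read; the binders at every `j ≤ n` are re-derived from those at `n`).
The (X).3 conjunct from a capped witness is Export7's own `exists_isTransferPkg7_of_step7`.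
Plumbing only; nothing about the model is asserted; nothing asserts any stub, K3 or superconductivity.  0 kit · 0 lit.
-/

noncomputable section

namespace Summit.HubbardSuperconductivity.HubbardSuperconductivity.Theorems.KLRegimeSplit

set_option linter.dupNamespace false -- summit = problem name (single-conjunct summit), D-0017

open Finset Matrix Set Literature.MathematicalPhysics.QuantumLattice Literature.Probability.LatticeModels
open Literature.MathematicalPhysics.QuantumLattice.FermiRG
open Summit.HubbardSuperconductivity.HubbardSuperconductivity.Theorems.KLProgrammeLegKernels
open Summit.HubbardSuperconductivity.HubbardSuperconductivity.Theorems.DispersionFlow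
open Summit.HubbardSuperconductivity.HubbardSuperconductivity.Theorems.EngineV8

/-! ## §1 `PairTransferStep7` = BASE + STEP (history at `G`, families at `Gth`) -/

section Step7

/-- **`pairTransferStep7_of_base_and_succ`** — the (X).3 class-#5 step from a BASE clause (the family at `n = 0`, keyed `Gth`, under Step7's binders) and a STEP clause
(`…K5 n → …K5 (n+1)` at `Gth` under Step7's binders at `n+1`).  Both clauses carry `PairTransferStep7`'s binder list verbatim at their scale (history at `G`). -/
theorem pairTransferStep7_of_base_and_succ {P : SplitConsts} {R : RenConsts} {Q₀ : EngConsts} {G Gth : GeoConsts} {r : ℝ} {u : EngConsts → ℝ → ℝ}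
    (hbase : G.WF → ∀ Q : EngConsts, Q₀.IsRaiseOf Q →
      ∀ cc : ℝ, 0 < cc → cc ≤ klEngC₃6 P R →
        ∀ μ ∈ klWindowC, ∀ U : ℝ, 0 < U → U ≤ klEngU₀10 P R cc → U ≤ u Q cc →
          ∀ β : ℝ, klBetaMin ≤ β → β ≤ Real.exp (cc / U ^ 2) →
            ∀ (L M : ℕ) [NeZero L] [NeZero M], klEngL₄ P R β U ≤ L → klEngM₃ β U L ≤ M →
              0 ≤ nScales β + 1 → IsKLRegime U cc (-((0 : ℕ) : ℤ)) →
                HistP klPredsV17F2 L M G P Q R β U μ 0 0 →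
                  FrameOK R U (nScales β) μ (klFlowFrameU L M β U μ 0) →
                    (∀ j ≤ 0, LevelsUExportMixedAt L M (klCU2 P R Q₀) P β U μ j) →
                      PairTransferRelFamilyK5 L M Gth P r β U μ 0)
    (hsucc : G.WF → ∀ Q : EngConsts, Q₀.IsRaiseOf Q →
      ∀ cc : ℝ, 0 < cc → cc ≤ klEngC₃6 P R →
        ∀ μ ∈ klWindowC, ∀ U : ℝ, 0 < U → U ≤ klEngU₀10 P R cc → U ≤ u Q cc →
          ∀ β : ℝ, klBetaMin ≤ β → β ≤ Real.exp (cc / U ^ 2) →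
            ∀ (L M : ℕ) [NeZero L] [NeZero M], klEngL₄ P R β U ≤ L → klEngM₃ β U L ≤ M →
              ∀ n : ℕ, n + 1 ≤ nScales β + 1 → IsKLRegime U cc (-((n + 1 : ℕ) : ℤ)) →
                HistP klPredsV17F2 L M G P Q R β U μ 0 (n + 1) →
                  FrameOK R U (nScales β) μ (klFlowFrameU L M β U μ (n + 1)) →
                    (∀ j ≤ n + 1, LevelsUExportMixedAt L M (klCU2 P R Q₀) P β U μ j) →
                      PairTransferRelFamilyK5 L M Gth P r β U μ n → PairTransferRelFamilyK5 L M Gth P r β U μ (n + 1)) :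
    PairTransferStep7 P R Q₀ G Gth r u := by
  intro hG Q hQ cc hcc0 hcc μ hμ U hU hU10 hUu β hβ hβc L M _ _ hL hM n hn hreg hhist hK hlev hfam
  cases n with
  | zero => exact hbase hG Q hQ cc hcc0 hcc μ hμ U hU hU10 hUu β hβ hβc L M hL hM hn hreg hhist hK hlev
  | succ n => exact hsucc hG Q hQ cc hcc0 hcc μ hμ U hU hU10 hUu β hβ hβc L M hL hM n hn hreg hhist hK hlev (hfam n (Nat.lt_succ_self n))

end Step7

/-! ## §2 `PairTransferStep7` from a PRIVATE invariant (history at `G`, export at `Gth`) -/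

section Private

set_option maxHeartbeats 800000 in -- long binder lists; plumbing
/-- **`pairTransferStep7_of_private`** — `PairTransferStep7 P R Q₀ G Gth r u` from a private invariant `Priv Q cc μ U β L M n` with BASE / STEP / EXPORT clauses under Step7's
binders (history at `G`; EXPORT concludes the K5 family at `Gth`; the Export7 twin of `pairTransferStep6_of_private`; the handed history `∀ j < n, …K5 j` is not read). -/
theorem pairTransferStep7_of_private {P : SplitConsts} {R : RenConsts} {Q₀ : EngConsts} {G Gth : GeoConsts} {r : ℝ} {u : EngConsts → ℝ → ℝ} (hR : R.WF2)
    (h0 : ∀ (U μ β : ℝ), μ ∈ klWindowC → FrameOK R U (nScales β) μ 0) (Priv : EngConsts → ℝ → ℝ → ℝ → ℝ → ℕ → ℕ → ℕ → Prop)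
    (hbase : G.WF → ∀ Q : EngConsts, Q₀.IsRaiseOf Q →
      ∀ cc : ℝ, 0 < cc → cc ≤ klEngC₃6 P R →
        ∀ μ ∈ klWindowC, ∀ U : ℝ, 0 < U → U ≤ klEngU₀10 P R cc → U ≤ u Q cc →
          ∀ β : ℝ, klBetaMin ≤ β → β ≤ Real.exp (cc / U ^ 2) →
            ∀ (L M : ℕ) [NeZero L] [NeZero M], klEngL₄ P R β U ≤ L → klEngM₃ β U L ≤ M →
              0 ≤ nScales β + 1 → IsKLRegime U cc (-((0 : ℕ) : ℤ)) →
                HistP klPredsV17F2 L M G P Q R β U μ 0 (0) →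
                  FrameOK R U (nScales β) μ (klFlowFrameU L M β U μ (0)) →
                    (∀ j ≤ 0, LevelsUExportMixedAt L M (klCU2 P R Q₀) P β U μ j) →
                      Priv Q cc μ U β L M 0)
    (hsucc : G.WF → ∀ Q : EngConsts, Q₀.IsRaiseOf Q →
      ∀ cc : ℝ, 0 < cc → cc ≤ klEngC₃6 P R →
        ∀ μ ∈ klWindowC, ∀ U : ℝ, 0 < U → U ≤ klEngU₀10 P R cc → U ≤ u Q cc →
          ∀ β : ℝ, klBetaMin ≤ β → β ≤ Real.exp (cc / U ^ 2) →
            ∀ (L M : ℕ) [NeZero L] [NeZero M], klEngL₄ P R β U ≤ L → klEngM₃ β U L ≤ M →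
              ∀ n : ℕ, n + 1 ≤ nScales β + 1 → IsKLRegime U cc (-((n + 1 : ℕ) : ℤ)) →
                HistP klPredsV17F2 L M G P Q R β U μ 0 (n + 1) →
                  FrameOK R U (nScales β) μ (klFlowFrameU L M β U μ (n + 1)) →
                    (∀ j ≤ n + 1, LevelsUExportMixedAt L M (klCU2 P R Q₀) P β U μ j) →
                      Priv Q cc μ U β L M n → Priv Q cc μ U β L M (n + 1))
    (hexport : G.WF → ∀ Q : EngConsts, Q₀.IsRaiseOf Q →
      ∀ cc : ℝ, 0 < cc → cc ≤ klEngC₃6 P R →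
        ∀ μ ∈ klWindowC, ∀ U : ℝ, 0 < U → U ≤ klEngU₀10 P R cc → U ≤ u Q cc →
          ∀ β : ℝ, klBetaMin ≤ β → β ≤ Real.exp (cc / U ^ 2) →
            ∀ (L M : ℕ) [NeZero L] [NeZero M], klEngL₄ P R β U ≤ L → klEngM₃ β U L ≤ M →
              ∀ n : ℕ, n ≤ nScales β + 1 → IsKLRegime U cc (-((n : ℕ) : ℤ)) →
                HistP klPredsV17F2 L M G P Q R β U μ 0 (n) →
                  FrameOK R U (nScales β) μ (klFlowFrameU L M β U μ (n)) →
                    (∀ j ≤ n, LevelsUExportMixedAt L M (klCU2 P R Q₀) P β U μ j) →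
                      Priv Q cc μ U β L M n → PairTransferRelFamilyK5 L M Gth P r β U μ n) :
    PairTransferStep7 P R Q₀ G Gth r u := by
  intro hG Q hQ cc hcc0 hcc μ hμ U hU hU10 hUu β hβ hβc L M _ _ hL hM n hn hreg hhist hK hlev _hfam
  have h0' : FrameOK R U (nScales β) μ 0 := h0 U μ β hμ
  -- every `j ≤ n` carries the binders at `j`
  have hregj : ∀ j ≤ n, IsKLRegime U cc (-((j : ℕ) : ℤ)) := fun j hj => isKLRegime_of_le_nScales_succ hcc0.le hβ hβc (hj.trans hn)
  have hhistj : ∀ j ≤ n, HistP klPredsV17F2 L M G P Q R β U μ 0 j := fun j hj => histP_klPredsV17F2_of_le hhist hj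
  have hKj : ∀ j ≤ n, FrameOK R U (nScales β) μ (klFlowFrameU L M β U μ j) := fun j hj =>
    frameOK_klFlowFrameU_of_histP hR h0' (hj.trans hn) (hhistj j hj)
  -- the private invariant at every `j ≤ n`, by induction
  have hpriv : ∀ j ≤ n, Priv Q cc μ U β L M j := by
    intro j
    induction j with
    | zero =>
        intro hj
        exact hbase hG Q hQ cc hcc0 hcc μ hμ U hU hU10 hUu β hβ hβc L M hL hM (hj.trans hn) (hregj 0 hj) (hhistj 0 hj) (hKj 0 hj)
          (fun i hi => hlev i (hi.trans hj))
    | succ j ih =>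
        intro hj
        exact hsucc hG Q hQ cc hcc0 hcc μ hμ U hU hU10 hUu β hβ hβc L M hL hM j (hj.trans hn) (hregj _ hj) (hhistj _ hj) (hKj _ hj)
          (fun i hi => hlev i (hi.trans hj)) (ih ((Nat.le_succ j).trans hj))
  exact hexport hG Q hQ cc hcc0 hcc μ hμ U hU hU10 hUu β hβ hβc L M hL hM n hn hreg hhist hK hlev (hpriv n le_rfl)

end Private

end Summit.HubbardSuperconductivity.HubbardSuperconductivity.Theorems.KLRegimeSplit

end
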